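import Literature.NumberTheory.LFunctions.TaoLogElliottLogAvg
import Literature.Probability.Entropy.EntropyOfWindows
import Literature.Probability.Entropy.EntropyDecoupling
import HarnessLib

/-!
# Tao's log-averaged Elliott theorem: translation invariance of the conditional block entropies

Part of the proof DAG below the named fact `Literature.NumberTheory.LFunctions.Tao2016_theorem23_core` (Tao, Forum Math. Pi 4
(2016) e8, the proof of Theorem 2.3).  The entropy decrement argument
(`Literature.NumberTheory.LFunctions.Tao2016.exists_scale_mutualInfo_le` / `Literature.Probability.Entropy.FiniteShannon.condEnt_window_mul_le`) consumes
one probabilistic input about the process `W_k(𝐧) = G(a𝐧 + k)` (in the paper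
`G = (g_{1,ε²}, g_{2,ε²})`) and the residues `Y_H(𝐧) = 𝐧 mod P_H` on Tao's logarithmic
probability space: the conditional entropy of the block `X_{jH,(j+1)H}` given `Y_H` exceeds that
of `X_{0,H}` by at most `o_{A→∞}(1)`.  In the paper (§3, between (3.11) and (3.12)) this is
"from Lemma 2.5 again … `𝐇(X_{H₁,H₁+H₂} | 𝐧 + H₁ (P_H)) = 𝐇(X_{H₂} | 𝐧 (P_H)) + o(1)`. But
`𝐧 + H₁ (P_H)` conveys exactly the same information as `𝐧 (P_H)`".  We PROVE it here, with an
explicit error, from the tree's quantitative Lemma 2.5 (`Literature.NumberTheory.LFunctions.Tao2016.norm_sum_shift_up_sub_le`,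
`TaoLogElliottLogAvg.lean`) and the continuity of entropy in the law
(`Literature.Probability.Entropy.FiniteShannon.abs_ent_sub_ent_le`):

* `logSpace x ω`, `logWeight` — the paper's `𝐧` as a finite weighted set for `Literature.FiniteShannon`
  (`mass = logWeightSum`);
* `abs_prob_shift_sub_le` — laws are translation invariant: `|ℙ(Z(𝐧+m) = v) - ℙ(Z(𝐧) = v)| ≤ 4m/∑1/n`;
* `window_congr`, `window_process_shift` — `X_{jH,(j+1)H}(𝐧) = X_{0,H}(𝐧 + m)` when `a m = j H`;
* `abs_prob_mod_sub_le`, `log_sub_le_ent_mod`, `ent_mod_le_log` — the residue `𝐧 mod P` is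
  nearly uniform (Lemma 2.5 with `q = P`, `X = 1`): `|ℙ(𝐧 ≡ r (P)) - 1/P| ≤ (8 + 2 log P)/S`,
  hence `log P - P (φ(η) + η) ≤ 𝐇(𝐧 mod P) ≤ log P`, `η = (8 + 2 log P)/S` — displays (3.9)
  (`𝐇(Y_H) = log P_H - o(1)`) and, with `log P_H ≤ ϑ(ε²H) ≪ H`, (3.10) of the paper;
* `condEnt_window_shift_le` — **the translation-invariance input**: for `a m = jH` and any finite
  `t` containing the values of `(X_{0,H}(𝐧), 𝐧 mod P)` and of `(X_{0,H}(𝐧+m), (𝐧+m) mod P)`,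
  `𝐇(X_{jH,(j+1)H} | 𝐧 mod P) ≤ 𝐇(X_{0,H} | 𝐧 mod P) + #t (φ(4m/S) + 4m/S)`, `S = ∑_{x/ω<n≤x} 1/n`,
  which is `o_{A→∞}(1)` for fixed `H₊` (this is the hypothesis `hTI` of
  `Literature.NumberTheory.LFunctions.Tao2016.exists_scale_mutualInfo_le`, the scales being multiples of `a`).

## References
* T. Tao, Forum Math. Pi 4 (2016), e8; arXiv:1509.05422, §3, the paragraph between (3.11) and
  (3.12); §2, Lemma 2.5 (translation invariance).

## Design choices
* Residues are read in `ℕ` (`n % P`), matching `exists_scale_mutualInfo_le`'s `Y : ℕ → ι → ℕ`.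
* The alphabet bound `t` is a parameter (in the application: lists of length `H` over the finite
  box of rounded values, times `range P`), so no `Fintype` structure on values is needed.
-/

open Finset Real

namespace Literature.NumberTheory.LFunctions

namespace Tao2016

open Literature.Probability.Entropy.FiniteShannon

/-! ### Tao's `𝐧` as a finite weighted set -/

/-- The support `{n : x/ω < n ≤ x}` of Tao's random integer `𝐧`. [cite: TaoFMP2016, §2 (definition of 𝐧)] -/
noncomputable def logSpace (x ω : ℝ) : Finset ℕ := Ioc ⌊x / ω⌋₊ ⌊x⌋₊

/-- The logarithmic weight `1/n` (`ℙ(𝐧 = n) ∝ 1/n`). [cite: TaoFMP2016, §2 (definition of 𝐧)] -/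
noncomputable def logWeight : ℕ → ℝ := fun n => (n : ℝ)⁻¹

/-- The weights are nonnegative. [folklore] -/
theorem logWeight_nonneg (x ω : ℝ) : ∀ n ∈ logSpace x ω, 0 ≤ logWeight n :=
  fun n _ => by unfold logWeight; positivity

/-- The total mass is `logWeightSum x ω = ∑_{x/ω < n ≤ x} 1/n`. [folklore] -/
theorem mass_logSpace (x ω : ℝ) : mass (logSpace x ω) logWeight = logWeightSum x ω := rfl

/-- The weighted sum of an indicator is the mass of the corresponding event (as a complex number).
[folklore] -/
theorem sum_ite_div_eq_mass {γ : Type*} [DecidableEq γ] (Z : ℕ → γ) (v : γ) (S : Finset ℕ) :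
    ∑ n ∈ S, (if Z n = v then (1 : ℂ) else 0) / (n : ℂ) =
      ((mass (S.filter fun n => Z n = v) logWeight : ℝ) : ℂ) := by
  rw [mass_def, Complex.ofReal_sum, sum_filter]
  refine sum_congr rfl fun n _ => ?_
  by_cases h : Z n = v
  · simp [h, logWeight]
  · simp [h]

/-- **Laws are approximately translation invariant** (Tao 2016, Lemma 2.5, translation form,
applied to an indicator): `|ℙ(Z(𝐧 + m) = v) - ℙ(Z(𝐧) = v)| ≤ 4m / ∑_{x/ω<n≤x} 1/n`.
[cite: TaoFMP2016, Lemma 2.5 (translation invariance)] -/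
theorem abs_prob_shift_sub_le {γ : Type*} [DecidableEq γ] (Z : ℕ → γ) (m : ℕ) (v : γ) {x ω : ℝ}
    (hS : 0 < logWeightSum x ω) :
    |prob (logSpace x ω) logWeight (fun n => Z (n + m)) v - prob (logSpace x ω) logWeight Z v| ≤
      4 * m / logWeightSum x ω := by
  set X : ℕ → ℂ := fun n => if Z n = v then 1 else 0 with hX
  have hXb : ∀ n, ‖X n‖ ≤ 1 := fun n => by
    simp only [hX]; split_ifs <;> simp
  have h := norm_sum_shift_up_sub_le hXb m ⌊x / ω⌋₊ ⌊x⌋₊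
  have e1 : ∑ n ∈ Ioc ⌊x / ω⌋₊ ⌊x⌋₊, X (n + m) / (n : ℂ) =
      ((mass ((logSpace x ω).filter fun n => Z (n + m) = v) logWeight : ℝ) : ℂ) :=
    sum_ite_div_eq_mass (fun n => Z (n + m)) v (logSpace x ω)
  have e2 : ∑ n ∈ Ioc ⌊x / ω⌋₊ ⌊x⌋₊, X n / (n : ℂ) =
      ((mass ((logSpace x ω).filter fun n => Z n = v) logWeight : ℝ) : ℂ) :=
    sum_ite_div_eq_mass Z v (logSpace x ω)
  rw [e1, e2, ← Complex.ofReal_sub, Complex.norm_real, Real.norm_eq_abs] at h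
  rw [prob_def, prob_def, mass_logSpace, ← sub_div, abs_div, abs_of_pos hS]
  exact div_le_div_of_nonneg_right h hS.le

/-! ### Blocks of the process `W_k(𝐧) = G(a𝐧 + k)` are translates -/

/-- Windows only depend on the relevant coordinates: pointwise equal data give equal windows.
[folklore] -/
theorem window_congr {ι α : Type*} (W₁ W₂ : ℕ → ι → α) (m₁ m₂ : ℕ) (i₁ i₂ : ι) (H : ℕ)
    (h : ∀ k, k < H → W₁ (m₁ + k + 1) i₁ = W₂ (m₂ + k + 1) i₂) :
    window W₁ m₁ H i₁ = window W₂ m₂ H i₂ := by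
  induction H with
  | zero => rfl
  | succ H ih =>
    rw [window_succ, window_succ, ih fun k hk => h k (Nat.lt_succ_of_lt hk), h H (Nat.lt_succ_self H)]

/-- The process of Tao 2016, §3: `W_k(n) = G(a n + k)` (in the paper `G = (g_{1,ε²}, g_{2,ε²})`).
[cite: TaoFMP2016, §2 (definition of X_H)] -/
def process {α : Type*} (G : ℕ → α) (a : ℕ) : ℕ → ℕ → α := fun k n => G (a * n + k)

/-- **`X_{jH,(j+1)H}(𝐧) = X_{0,H}(𝐧 + m)` when `a m = j H`** (the block of the process at `jH`
is the initial block at the translated integer). [cite: TaoFMP2016, §3 (between (3.11) and (3.12))] -/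
theorem window_process_shift {α : Type*} (G : ℕ → α) {a H j m : ℕ} (hm : a * m = j * H) (n : ℕ) :
    window (process G a) (j * H) H n = window (process G a) 0 H (n + m) :=
  window_congr _ _ _ _ _ _ H fun k _ => by
    simp only [process]
    congr 1
    rw [Nat.mul_add, hm]
    ring

/-! ### The translation-invariance input of the entropy decrement argument -/

/-- Relabelling of residues undoing a translation by `m`: `((r + m) % P + (P - m % P)) % P = r % P`.
[folklore] -/
theorem mod_shift_cancel {P : ℕ} (hP : 0 < P) (n m : ℕ) :
    ((n + m) % P + (P - m % P)) % P = n % P := by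
  have hmP : m % P ≤ P := (Nat.mod_lt m hP).le
  have key : (n + m) % P + (P - m % P) ≡ n [MOD P] := by
    have h1 : (n + m) % P ≡ n + m [MOD P] := Nat.mod_modEq _ _
    have h2 : n + m + (P - m % P) ≡ n [MOD P] := by
      -- `m + (P - m % P) = (m - m % P) + P ≡ 0`
      have h3 : m % P + (m / P) * P = m := by
        have := Nat.mod_add_div m P; linarith [Nat.mul_comm P (m / P)]
      have : n + m + (P - m % P) = n + ((m / P) * P + P) := by omega
      rw [this]
      calc n + (m / P * P + P) = n + (m / P + 1) * P := by ring
        _ ≡ n + 0 [MOD P] := Nat.ModEq.add_left _ (Nat.modEq_zero_iff_dvd.2 (Dvd.intro_left _ rfl))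
        _ = n := by ring
    exact (Nat.ModEq.add_right _ h1).trans h2
  exact key

/-- **Approximate translation invariance of the conditional block entropies** (Tao 2016, §3:
"`𝐇(X_{H₁,H₁+H₂} | 𝐧 + H₁ (P_H)) = 𝐇(X_{H₂} | 𝐧 (P_H)) + o_{A→∞}(1)`" and "`𝐧 + H₁ (P_H)` conveys
exactly the same information as `𝐧 (P_H)`").  Let `W_k(𝐧) = G(a𝐧 + k)`, `Y(𝐧) = 𝐧 mod P`, and
`a m = j H`.  If a finite set `t` contains the values of `(X_{0,H}(𝐧), 𝐧 mod P)` and of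
`(X_{0,H}(𝐧 + m), (𝐧 + m) mod P)` for `x/ω < 𝐧 ≤ x`, and `4m ≤ S = ∑_{x/ω<n≤x} 1/n`, then
`𝐇(X_{jH,(j+1)H} | Y) ≤ 𝐇(X_{0,H} | Y) + #t (φ(4m/S) + 4m/S)` (`φ = negMulLog`).
This is the hypothesis `hTI` of `Literature.NumberTheory.LFunctions.Tao2016.exists_scale_mutualInfo_le` with
`δ = #t (φ(4m/S) + 4m/S) = o_{A→∞}(1)`.
[cite: TaoFMP2016, §3 (paragraph between (3.11) and (3.12))] -/
theorem condEnt_window_shift_le {α : Type*} [DecidableEq α] (G : ℕ → α) {a P H j m : ℕ}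
    (hP : 0 < P) (hm : a * m = j * H) {x ω : ℝ} (hS : 0 < logWeightSum x ω)
    (hmS : 4 * (m : ℝ) ≤ logWeightSum x ω) {t : Finset (List α × ℕ)}
    (ht : (logSpace x ω).image (fun n => (window (process G a) 0 H n, n % P)) ⊆ t)
    (ht' : (logSpace x ω).image (fun n => (window (process G a) 0 H (n + m), (n + m) % P)) ⊆ t) :
    condEnt (logSpace x ω) logWeight (window (process G a) (j * H) H) (fun n => n % P) ≤
      condEnt (logSpace x ω) logWeight (window (process G a) 0 H) (fun n => n % P) +
        #t * (negMulLog (4 * m / logWeightSum x ω) + 4 * m / logWeightSum x ω) := by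
  set s := logSpace x ω with hs
  set w := logWeight with hw_def
  have hw : ∀ i ∈ s, 0 ≤ w i := logWeight_nonneg x ω
  set W := process G a with hW
  set Y : ℕ → ℕ := fun n => n % P with hY
  -- the two joint variables
  set Z₀ : ℕ → List α × ℕ := fun n => (window W 0 H n, Y n) with hZ₀
  set Z₀' : ℕ → List α × ℕ := fun n => (window W 0 H (n + m), Y (n + m)) with hZ₀'
  -- chain rule: `condEnt = ent (pair) - ent Y`
  have hc0 : condEnt s w (window W 0 H) Y = ent s w Z₀ - ent s w Y := by
    rw [hZ₀, ent_pair_eq_add_condEnt hw]; ring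
  have hcj : condEnt s w (window W (j * H) H) Y =
      ent s w (fun n => (window W (j * H) H n, Y n)) - ent s w Y := by
    rw [ent_pair_eq_add_condEnt hw]; ring
  -- the pair at `jH` is an injective relabelling of `Z₀'`
  set Φ : List α × ℕ → List α × ℕ := fun p => (p.1, (p.2 + (P - m % P)) % P) with hΦ
  have hrel : (fun n => (window W (j * H) H n, Y n)) = Φ ∘ Z₀' := by
    funext n
    simp only [Function.comp, hΦ, hZ₀', hY, hW]
    rw [window_process_shift G hm n, mod_shift_cancel hP n m]
  have hinj : Set.InjOn Φ (s.image Z₀') := by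
    intro p hp q hq hpq
    simp only [coe_image, Set.mem_image, mem_coe, hZ₀'] at hp hq
    obtain ⟨n₁, -, rfl⟩ := hp
    obtain ⟨n₂, -, rfl⟩ := hq
    simp only [hΦ, Prod.mk.injEq] at hpq ⊢
    refine ⟨hpq.1, ?_⟩
    have h1 := mod_shift_cancel hP n₁ m
    have h2 := mod_shift_cancel hP n₂ m
    simp only [hY] at hpq
    -- both residues `(nᵢ + m) % P` are determined by `nᵢ % P`
    have e : n₁ % P = n₂ % P := by rw [← h1, ← h2, hpq.2]
    show (n₁ + m) % P = (n₂ + m) % P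
    rw [Nat.add_mod, e, ← Nat.add_mod]
  have hent : ent s w (fun n => (window W (j * H) H n, Y n)) = ent s w Z₀' := by
    rw [hrel]; exact ent_comp_of_injOn hinj
  -- continuity of entropy: the laws of `Z₀'` and `Z₀` are `4m/S`-close
  have hδ1 : 4 * (m : ℝ) / logWeightSum x ω ≤ 1 := by
    rw [div_le_one hS]; exact hmS
  have hclose : ∀ v ∈ t, |prob s w Z₀' v - prob s w Z₀ v| ≤ 4 * m / logWeightSum x ω :=
    fun v _ => abs_prob_shift_sub_le Z₀ m v hS
  have hcont := abs_ent_sub_ent_le hw hw ht' ht hδ1 hclose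
  rw [abs_le] at hcont
  rw [hcj, hc0, hent]
  linarith [hcont.2]

/-! ### The residue `𝐧 mod P` is nearly uniform: displays (3.9) and (3.10) -/

/-- `𝔼 1 = 1` on a non-degenerate range. [folklore] -/
theorem logAvg_one {x ω : ℝ} (hS : 0 < logWeightSum x ω) : logAvg (fun _ => (1 : ℂ)) x ω = 1 := by
  unfold logAvg wsum logWeightSum
  have hS' : ((∑ n ∈ Ioc ⌊x / ω⌋₊ ⌊x⌋₊, (n : ℝ)⁻¹ : ℝ) : ℂ) ≠ 0 := by
    exact_mod_cast hS.ne'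
  rw [div_eq_one_iff_eq hS']
  push_cast
  exact sum_congr rfl fun n _ => by rw [one_div]

/-- **Near-uniformity of `𝐧 mod P`** (Tao 2016, Lemma 2.5 with `q = P`, `X = 1`: "`Y_H` is within
`o_{A→∞}(1)` of being uniformly distributed on `ℤ/P_Hℤ`"): for `r < P`,
`|ℙ(𝐧 mod P = r) - 1/P| ≤ (8 + 2 log P) / ∑_{x/ω<n≤x} 1/n`. [cite: TaoFMP2016, §3 (3.9) and Lemma 2.5] -/
theorem abs_prob_mod_sub_le {P r : ℕ} (hP : 0 < P) (hr : r < P) {x ω : ℝ}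
    (hS : 0 < logWeightSum x ω) :
    |prob (logSpace x ω) logWeight (fun n => n % P) r - 1 / P| ≤
      (8 + 2 * Real.log P) / logWeightSum x ω := by
  have h := norm_logAvg_filter_mod_sub_le (X := fun _ => (1 : ℂ)) (fun _ => by simp) hP hr hS
    (x := x) (ω := ω)
  rw [logAvg_one hS, mul_one] at h
  have e1 : logAvg (fun n => if n % P = r then (1 : ℂ) else 0) x ω =
      ((prob (logSpace x ω) logWeight (fun n => n % P) r : ℝ) : ℂ) := by
    unfold logAvg wsum
    rw [prob_def, mass_logSpace, Complex.ofReal_div]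
    congr 1
    exact sum_ite_div_eq_mass (fun n => n % P) r (logSpace x ω)
  rw [e1, show (1 : ℂ) / (P : ℂ) = ((1 / (P : ℝ) : ℝ) : ℂ) by push_cast; rfl,
    ← Complex.ofReal_sub, Complex.norm_real, Real.norm_eq_abs] at h
  exact h

/-- The residues lie in `range P`. [folklore] -/
theorem image_mod_subset_range {P : ℕ} (hP : 0 < P) (s : Finset ℕ) :
    s.image (fun n => n % P) ⊆ range P := by
  intro r hr
  obtain ⟨n, -, rfl⟩ := mem_image.1 hr
  exact mem_range.2 (Nat.mod_lt n hP)

/-- **Display (3.9) of Tao 2016, lower bound**: `𝐇(𝐧 mod P) ≥ log P - P (φ(η) + η)` with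
`η = (8 + 2 log P)/S ≤ 1` (`S = ∑_{x/ω<n≤x} 1/n`), from near-uniformity and
`Literature.Probability.Entropy.FiniteShannon.log_card_sub_le_ent_of_near_uniform`. [cite: TaoFMP2016, §3 (3.9)] -/
theorem log_sub_le_ent_mod {P : ℕ} (hP : 0 < P) {x ω : ℝ} (hS : 0 < logWeightSum x ω)
    (hη : 8 + 2 * Real.log P ≤ logWeightSum x ω) :
    Real.log P - P * (negMulLog ((8 + 2 * Real.log P) / logWeightSum x ω) +
        (8 + 2 * Real.log P) / logWeightSum x ω) ≤
      ent (logSpace x ω) logWeight (fun n => n % P) := by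
  have h := log_card_sub_le_ent_of_near_uniform (s := logSpace x ω) (w := logWeight)
    (logWeight_nonneg x ω) (fun n => n % P) (T := range P) (image_mod_subset_range hP _)
    (δ := (8 + 2 * Real.log P) / logWeightSum x ω) (by rw [div_le_one hS]; exact hη)
    (fun r hr => by
      have := abs_prob_mod_sub_le hP (mem_range.1 hr) hS (x := x) (ω := ω)
      rwa [card_range])
  rwa [card_range] at h

/-- **Display (3.10) of Tao 2016, the crude bound**: `𝐇(𝐧 mod P) ≤ log P` (and `log P_H ≤ ϑ(ε²H)
≪ H` by Chebyshev). [cite: TaoFMP2016, §3 (3.10)] -/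
theorem ent_mod_le_log {P : ℕ} (hP : 0 < P) (x ω : ℝ) :
    ent (logSpace x ω) logWeight (fun n => n % P) ≤ Real.log P := by
  have h := ent_le_log_card (s := logSpace x ω) (w := logWeight) (X := fun n => n % P)
    (logWeight_nonneg x ω) (image_mod_subset_range hP _)
  rwa [card_range] at h

end Tao2016

end Literature.NumberTheory.LFunctions
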